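import Literature.NumberTheory.EllipticCurves.ModFiveCongruenceHesseFamily
import HarnessLib

/-!
# STUB-IDEAS `stub_switch` — k3, GENERATION 9, part 1/2: Klein forms and Fisher's Lemma 8.4 (SORRY-FREE)

Companion (algebraic half) of `STUB-IDEAS-stub_switch-3.md`, generation 9.  Everything in this file is
PROVED (no `sorry`): Klein's icosahedral forms `D, c₄^{Kl}, c₆^{Kl}` and their syzygy; Fisher's
Lemma 8.4 in the TREE normalisation of the Hesse polynomials `𝔇, 𝔠₄` of
`Literature/NumberTheory/EllipticCurves/ModFiveCongruenceHessePolynomials.lean`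
(`lemma84_D` by `ring`, ≈ 20 s; `lemma84_C4` by the Hessian chain rule — three L84-D-sized `ring`
identities + Klein's `Hess(D) = −121c₄^{Kl}` + covariance); the Hesse syzygy over any field of
characteristic `0`; and the EXPLICIT GOOD ROOT `t_e(v) = M_v⁻¹(e)` of `𝔠₆(c₄^{Kl}(v), c₆^{Kl}(v); ·, 1)`
attached to a torsor point `v` and an edge midpoint `e` of the icosahedron (`goodRoot_tE`).
Part 2 (`STUB_IDEAS_stub_switch_3g9_Sketch.lean`) imports this module and adds the Galois descent
and the kernel-checked assembly to k3-g4's `Core1728`.  (A one-shot `ring` proof of L84-C4 exists —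
380 s, rc 0 once — but its certificate trips the farm kernel's memory cap; hence the chain rule.)

Sources: [Fisher2012Hessian] T. Fisher, *The Hessian of a genus one curve*, Proc. LMS 104 (2012),
arXiv:math/0610403 — §3 p.5 (Klein forms), Lemma 8.4 p.12–13; F. Klein, *Vorlesungen über das
Ikosaeder* (1884) I §§11–13; kit job j345205 (PARI: A1–A2 Klein syzygy/expansions, B0–B2 Lemma 8.4
with the tree constants `17424 = 12²·11²`, `240 = 12·20`, exact).
-/

set_option linter.dupNamespace false

noncomputable section

namespace Summit.ABC.ABC.Cruxes.FreyModularity.StubSwitchK3g9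

open Literature.NumberTheory.EllipticCurves Literature.NumberTheory.EllipticCurves.HesseFamilyFive

/-! ## §1 Klein's icosahedral forms (Fisher §3 p.5, `n = 5`; Klein 1884) — all PROVED

`D = ab(a¹⁰ − 11a⁵b⁵ − b¹⁰)` (12 vertices), `c₄^{Kl} = −Hess(D)/121` (20 face centres),
`c₆^{Kl} = Jac(D, c₄^{Kl})/20` (30 edge midpoints), `(c₄^{Kl})³ − (c₆^{Kl})² = 1728 D⁵`
(kit j345205 A1–A2 printed the expanded forms used here). -/

section Klein
variable {R : Type*} [CommRing R]

def kD (a b : R) : R := a ^ 11 * b - 11 * a ^ 6 * b ^ 6 - a * b ^ 11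
/-- `∂D/∂a`. -/
def kDa (a b : R) : R := 11 * a ^ 10 * b - 66 * a ^ 5 * b ^ 6 - b ^ 11
/-- `∂D/∂b`. -/
def kDb (a b : R) : R := a ^ 11 - 66 * a ^ 6 * b ^ 5 - 11 * a * b ^ 10
def kC4 (a b : R) : R :=
  a ^ 20 + 228 * a ^ 15 * b ^ 5 + 494 * a ^ 10 * b ^ 10 - 228 * a ^ 5 * b ^ 15 + b ^ 20
def kC6 (a b : R) : R :=
  -a ^ 30 + 522 * a ^ 25 * b ^ 5 + 10005 * a ^ 20 * b ^ 10 + 10005 * a ^ 10 * b ^ 20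
    - 522 * a ^ 5 * b ^ 25 - b ^ 30
/-- Fisher's `M_v(λ,μ) = (λa − μ∂_bD, λb + μ∂_aD)` (Lemma 8.4), first and second coordinate. -/
def Mv1 (a b l m : R) : R := l * a - m * kDb a b
def Mv2 (a b l m : R) : R := l * b + m * kDa a b

theorem klein_euler (a b : R) : a * kDa a b + b * kDb a b = 12 * kD a b := by
  simp only [kD, kDa, kDb]; ring

set_option maxHeartbeats 4000000 in
theorem klein_syzygy (a b : R) : kC4 a b ^ 3 - kC6 a b ^ 2 = 1728 * kD a b ^ 5 := by
  simp only [kD, kC4, kC6]; ring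

theorem kD_smul (s a b : R) : kD (s * a) (s * b) = s ^ 12 * kD a b := by
  simp only [kD]; ring
theorem kC4_smul (s a b : R) : kC4 (s * a) (s * b) = s ^ 20 * kC4 a b := by
  simp only [kC4]; ring
theorem kC6_smul (s a b : R) : kC6 (s * a) (s * b) = s ^ 30 * kC6 a b := by
  simp only [kC6]; ring

/-- The edge midpoint `(i : 1)`: `c₆^{Kl}(i,1) = 0` (Klein's `T` vanishes at `±i`). -/
theorem kC6_I (i : R) (hi : i ^ 2 = -1) : kC6 i 1 = 0 := by
  have e5 : i ^ 5 = i := by rw [show i ^ 5 = (i ^ 2) ^ 2 * i by ring, hi]; ring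
  have e10 : i ^ 10 = -1 := by rw [show i ^ 10 = (i ^ 2) ^ 5 by ring, hi]; ring
  have e20 : i ^ 20 = 1 := by rw [show i ^ 20 = (i ^ 2) ^ 10 by ring, hi]; ring
  have e25 : i ^ 25 = i := by rw [show i ^ 25 = (i ^ 2) ^ 12 * i by ring, hi]; ring
  have e30 : i ^ 30 = -1 := by rw [show i ^ 30 = (i ^ 2) ^ 15 by ring, hi]; ring
  simp only [kC6]
  linear_combination (-1 : R) * e30 + 522 * e25 + 10005 * e20 + 10005 * e10 - 522 * e5

end Klein

section KleinField
variable {F : Type*} [Field F]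

/-- … and `c₄^{Kl}(i,1) = −492 − 456i ≠ 0` (it is not a face centre). -/
theorem kC4_I_ne [CharZero F] (i : F) (hi : i ^ 2 = -1) : kC4 i 1 ≠ 0 := by
  have e5 : i ^ 5 = i := by rw [show i ^ 5 = (i ^ 2) ^ 2 * i by ring, hi]; ring
  have e10 : i ^ 10 = -1 := by rw [show i ^ 10 = (i ^ 2) ^ 5 by ring, hi]; ring
  have e15 : i ^ 15 = -i := by rw [show i ^ 15 = (i ^ 2) ^ 7 * i by ring, hi]; ring
  have e20 : i ^ 20 = 1 := by rw [show i ^ 20 = (i ^ 2) ^ 10 by ring, hi]; ring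
  intro h
  simp only [kC4] at h
  have key : (456 : F) * i = -492 := by
    linear_combination -h + e20 + 228 * e15 + 494 * e10 - 228 * e5
  have h2 : (456 : F) ^ 2 * i ^ 2 = (-492) ^ 2 := by rw [← mul_pow, key]
  rw [hi] at h2
  norm_num at h2

/-- `Δ ≠ 0 ⟹ D(v) ≠ 0` on the torsor. -/
theorem kD_ne_zero_of_ne (a b : F) (h : kC4 a b ^ 3 ≠ kC6 a b ^ 2) : kD a b ≠ 0 := by
  intro hD
  apply h
  have := klein_syzygy a b
  rw [hD] at this
  exact sub_eq_zero.mp (by simpa using this)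

/-- A torsor point is never proportional to an edge midpoint when `c₆ ≠ 0`. -/
theorem edge_nondeg (a b e₁ e₂ : F) (he6 : kC6 e₁ e₂ = 0) (he4 : kC4 e₁ e₂ ≠ 0)
    (h6 : kC6 a b ≠ 0) : e₂ * a - e₁ * b ≠ 0 := by
  intro h
  have hab : e₂ * a = e₁ * b := sub_eq_zero.mp h
  by_cases he2 : e₂ = 0
  · subst he2
    have he1 : e₁ ≠ 0 := by rintro rfl; exact he4 (by simp [kC4])
    have hb : b = 0 := by
      rcases mul_eq_zero.mp (show e₁ * b = 0 by rw [← hab]; ring) with h | h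
      · exact absurd h he1
      · exact h
    subst hb
    have h60 : kC6 e₁ (0 : F) = -e₁ ^ 30 := by simp [kC6]
    rw [h60, neg_eq_zero] at he6
    exact he1 (pow_eq_zero_iff (by norm_num) |>.mp he6)
  · have key : e₂ ^ 30 * kC6 a b = b ^ 30 * kC6 e₁ e₂ := by
      rw [← kC6_smul, ← kC6_smul, hab, mul_comm e₂ b, mul_comm e₁ b]
    rw [he6, mul_zero] at key
    rcases mul_eq_zero.mp key with h' | h'
    · exact he2 (pow_eq_zero_iff (by norm_num) |>.mp h')
    · exact h6 h'

/-! ## §2 Fisher Lemma 8.4 with the TREE normalisation (PROVED by `ring`; kit j345205 B1–B2)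

`𝔇(c₄^{Kl}(v), c₆^{Kl}(v); λ, μ)·D(v) = D(M_v(λ,μ))`, `𝔠₄(…; λ, μ) = c₄^{Kl}(M_v(λ,μ))`,
`𝔠₆(…; λ, μ) = c₆^{Kl}(M_v(λ,μ))` — no stray constants (`17424 = 12²·11²`, `240 = 12·20`).  The
`𝔠₆` identity (kit B2, exact) is NOT proved here and not needed: `goodRoot_tE` evaluates the Hesse
syzygy `𝔠₆² = 𝔠₄³ − Δ𝔇⁵` instead. -/

set_option maxHeartbeats 40000000 in
/-- **L84-D (PROVED, `ring`, ≈ 20 s).** [Fisher2012Hessian Lemma 8.4 p.12] -/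
theorem lemma84_D (a b l m : F) :
    D (kC4 a b) (kC6 a b) l m * kD a b = kD (Mv1 a b l m) (Mv2 a b l m) := by
  simp only [D, kC4, kC6, kD, Mv1, Mv2, kDa, kDb]
  ring

/-! ### L84-C4 WITHOUT a giant `ring`: Hessian chain rule (kernel-light)

A direct `ring` proof of `𝔠₄(K; λ, μ) = c₄^{Kl}(M_v(λ,μ))` elaborates (≈ 380 s) but its certificate
overflows the farm kernel's memory cap on loaded nodes.  Instead: differentiate L84-D twice
(`chain_ll/lm/mm`: the tree's `Dll, Dlm, Dmm` ARE the second partials of `𝔇`, so these are polynomial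
identities of the size of L84-D), use Klein's `Hess(D) = −121·c₄^{Kl}` and the covariance of the
Hessian under the linear substitution `M_v` (`det = a∂_aD + b∂_bD = 12D`, Euler). -/

/-- second partials of Klein's `D`. -/
def kDaa (a b : F) : F := 110 * a ^ 9 * b - 330 * a ^ 4 * b ^ 6
def kDab (a b : F) : F := 11 * a ^ 10 - 396 * a ^ 5 * b ^ 5 - 11 * b ^ 10
def kDbb (a b : F) : F := -330 * a ^ 6 * b ^ 4 - 110 * a * b ^ 9

/-- Klein: `Hess(D) = −121·c₄^{Kl}`. -/
theorem klein_hessian (a b : F) : kDaa a b * kDbb a b - kDab a b ^ 2 = -121 * kC4 a b := by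
  simp only [kDaa, kDab, kDbb, kC4]; ring

set_option maxHeartbeats 40000000 in
/-- `∂²/∂λ²` of L84-D. -/
theorem chain_ll (a b l m : F) :
    Dll (kC4 a b) (kC6 a b) l m * kD a b =
      a ^ 2 * kDaa (Mv1 a b l m) (Mv2 a b l m) + 2 * a * b * kDab (Mv1 a b l m) (Mv2 a b l m)
        + b ^ 2 * kDbb (Mv1 a b l m) (Mv2 a b l m) := by
  simp only [Dll, kC4, kC6, kD, kDaa, kDab, kDbb, Mv1, Mv2, kDa, kDb]; ring

set_option maxHeartbeats 40000000 in
/-- `∂²/∂λ∂μ` of L84-D (`∂_μ M_v = (−∂_bD(v), ∂_aD(v))`). -/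
theorem chain_lm (a b l m : F) :
    Dlm (kC4 a b) (kC6 a b) l m * kD a b =
      -(a * kDb a b) * kDaa (Mv1 a b l m) (Mv2 a b l m)
        + (a * kDa a b - b * kDb a b) * kDab (Mv1 a b l m) (Mv2 a b l m)
        + b * kDa a b * kDbb (Mv1 a b l m) (Mv2 a b l m) := by
  simp only [Dlm, kC4, kC6, kD, kDaa, kDab, kDbb, Mv1, Mv2, kDa, kDb]; ring

set_option maxHeartbeats 40000000 in
/-- `∂²/∂μ²` of L84-D. -/
theorem chain_mm (a b l m : F) :
    Dmm (kC4 a b) (kC6 a b) l m * kD a b =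
      kDb a b ^ 2 * kDaa (Mv1 a b l m) (Mv2 a b l m)
        - 2 * kDa a b * kDb a b * kDab (Mv1 a b l m) (Mv2 a b l m)
        + kDa a b ^ 2 * kDbb (Mv1 a b l m) (Mv2 a b l m) := by
  simp only [Dmm, kC4, kC6, kD, kDaa, kDab, kDbb, Mv1, Mv2, kDa, kDb]; ring

/-- **L84-C4 (PROVED).** `𝔠₄(c₄^{Kl}(v), c₆^{Kl}(v); λ, μ) = c₄^{Kl}(M_v(λ, μ))` for `D(v) ≠ 0`.
[Fisher2012Hessian Lemma 8.4; kit j345205 B1–B2 (exact, all `(λ, μ)`)] -/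
theorem lemma84_C4 [CharZero F] (a b l m : F) (hD : kD a b ≠ 0) :
    C4 (kC4 a b) (kC6 a b) l m = kC4 (Mv1 a b l m) (Mv2 a b l m) := by
  have hll := chain_ll a b l m
  have hlm := chain_lm a b l m
  have hmm := chain_mm a b l m
  have heul := klein_euler a b
  have hhess := klein_hessian (Mv1 a b l m) (Mv2 a b l m)
  have hk2 : kD a b ^ 2 ≠ 0 := pow_ne_zero _ hD
  have h2 : Dll (kC4 a b) (kC6 a b) l m * Dmm (kC4 a b) (kC6 a b) l m
      - Dlm (kC4 a b) (kC6 a b) l m ^ 2 = -17424 * kC4 (Mv1 a b l m) (Mv2 a b l m) := by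
    apply mul_right_cancel₀ hk2
    linear_combination (Dmm (kC4 a b) (kC6 a b) l m * kD a b) * hll
      + (a ^ 2 * kDaa (Mv1 a b l m) (Mv2 a b l m) + 2 * a * b * kDab (Mv1 a b l m) (Mv2 a b l m)
          + b ^ 2 * kDbb (Mv1 a b l m) (Mv2 a b l m)) * hmm
      - (Dlm (kC4 a b) (kC6 a b) l m * kD a b
          + (-(a * kDb a b) * kDaa (Mv1 a b l m) (Mv2 a b l m)
            + (a * kDa a b - b * kDb a b) * kDab (Mv1 a b l m) (Mv2 a b l m)
            + b * kDa a b * kDbb (Mv1 a b l m) (Mv2 a b l m))) * hlm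
      + ((kDaa (Mv1 a b l m) (Mv2 a b l m) * kDbb (Mv1 a b l m) (Mv2 a b l m)
          - kDab (Mv1 a b l m) (Mv2 a b l m) ^ 2) * (a * kDa a b + b * kDb a b + 12 * kD a b)) * heul
      + (144 * kD a b ^ 2) * hhess
  rw [C4, h2]
  field_simp

set_option maxHeartbeats 16000000 in
/-- **Hesse syzygy at `μ = 1` over any field of characteristic `0` (PROVED; k2-g5 proved the `ℚ`
case `hesse_syzygy_five_m1` by the same script, ≈ 70 s).** [Fisher2012Hessian Thm 8.5/(8.1)] -/
theorem hesse_syzygy_F [CharZero F] (c₄ c₆ l : F) :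
    C4 c₄ c₆ l 1 ^ 3 - C6 c₄ c₆ l 1 ^ 2 = (c₄ ^ 3 - c₆ ^ 2) * D c₄ c₆ l 1 ^ 5 := by
  simp only [C4, C6, C4l, C4m, D, Dl, Dm, Dll, Dlm, Dmm, Dlll, Dllm, Dlmm, Dmmm]
  field_simp
  ring

/-! ## §3 The explicit good root `t_e(v) = M_v⁻¹(e)` — PROVED (replaces g8 ROOT / g4 G3) -/

/-- `t_e(v)`: the preimage of the point `(e₁ : e₂)` under the Möbius map `M_v`. -/
def tE (a b e₁ e₂ : F) : F := (e₂ * kDb a b + e₁ * kDa a b) / (e₂ * a - e₁ * b)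

/-- `M_v(t_e(v), 1) = (12 D(v)/(e₂a − e₁b))·(e₁, e₂)` (Euler's identity). -/
theorem Mv_at_tE (a b e₁ e₂ : F) (hne : e₂ * a - e₁ * b ≠ 0) :
    Mv1 a b (tE a b e₁ e₂) 1 = e₁ * (12 * kD a b) / (e₂ * a - e₁ * b) ∧
      Mv2 a b (tE a b e₁ e₂) 1 = e₂ * (12 * kD a b) / (e₂ * a - e₁ * b) := by
  constructor
  · simp only [Mv1, tE]
    have h : (e₂ * kDb a b + e₁ * kDa a b) / (e₂ * a - e₁ * b) * a - 1 * kDb a b =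
        e₁ * (a * kDa a b + b * kDb a b) / (e₂ * a - e₁ * b) := by
      field_simp
      ring
    rw [h, klein_euler]
  · simp only [Mv2, tE]
    have h : (e₂ * kDb a b + e₁ * kDa a b) / (e₂ * a - e₁ * b) * b + 1 * kDa a b =
        e₂ * (a * kDa a b + b * kDb a b) / (e₂ * a - e₁ * b) := by
      field_simp
      ring
    rw [h, klein_euler]

/-- **H-ROOT (PROVED from L84-D, L84-C4, the two syzygies and `M_v(t_e) ∝ e`):** for every
torsor point `v = (a,b)` (`D(v) ≠ 0`) and every edge midpoint `e = (e₁:e₂)`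
(`c₆^{Kl}(e) = 0 ≠ c₄^{Kl}(e)`) not proportional to `v`, `t_e(v)` is a GOOD ROOT:
`𝔠₆(t_e,1) = 0 ≠ 𝔠₄(t_e,1)`.  (No `L84-C6` needed: `𝔠₆² = 𝔠₄³ − Δ𝔇⁵` is evaluated.) -/
theorem goodRoot_tE [CharZero F] (a b e₁ e₂ : F) (he6 : kC6 e₁ e₂ = 0) (he4 : kC4 e₁ e₂ ≠ 0)
    (hD : kD a b ≠ 0) (hne : e₂ * a - e₁ * b ≠ 0) :
    C6 (kC4 a b) (kC6 a b) (tE a b e₁ e₂) 1 = 0 ∧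
      C4 (kC4 a b) (kC6 a b) (tE a b e₁ e₂) 1 ≠ 0 := by
  obtain ⟨h1, h2⟩ := Mv_at_tE a b e₁ e₂ hne
  set s : F := 12 * kD a b / (e₂ * a - e₁ * b) with hs_def
  have hs : s ≠ 0 := div_ne_zero (mul_ne_zero (by norm_num) hD) hne
  have hM1 : Mv1 a b (tE a b e₁ e₂) 1 = s * e₁ := by rw [h1, hs_def]; ring
  have hM2 : Mv2 a b (tE a b e₁ e₂) 1 = s * e₂ := by rw [h2, hs_def]; ring
  have h4 : C4 (kC4 a b) (kC6 a b) (tE a b e₁ e₂) 1 = s ^ 20 * kC4 e₁ e₂ := by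
    rw [lemma84_C4 a b _ _ hD, hM1, hM2, kC4_smul]
  have hDD : D (kC4 a b) (kC6 a b) (tE a b e₁ e₂) 1 * kD a b = s ^ 12 * kD e₁ e₂ := by
    rw [lemma84_D, hM1, hM2, kD_smul]
  refine ⟨?_, by rw [h4]; exact mul_ne_zero (pow_ne_zero _ hs) he4⟩
  have hsyz := hesse_syzygy_F (kC4 a b) (kC6 a b) (tE a b e₁ e₂)
  have hK := klein_syzygy a b
  have hKe := klein_syzygy e₁ e₂
  have hsq : C6 (kC4 a b) (kC6 a b) (tE a b e₁ e₂) 1 ^ 2 = 0 := by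
    calc C6 (kC4 a b) (kC6 a b) (tE a b e₁ e₂) 1 ^ 2
        = C4 (kC4 a b) (kC6 a b) (tE a b e₁ e₂) 1 ^ 3
            - (kC4 a b ^ 3 - kC6 a b ^ 2) * D (kC4 a b) (kC6 a b) (tE a b e₁ e₂) 1 ^ 5 := by
          linear_combination (-1 : F) * hsyz
      _ = (s ^ 20 * kC4 e₁ e₂) ^ 3
            - 1728 * (D (kC4 a b) (kC6 a b) (tE a b e₁ e₂) 1 * kD a b) ^ 5 := by
          rw [h4, hK]; ring
      _ = (s ^ 20 * kC4 e₁ e₂) ^ 3 - 1728 * (s ^ 12 * kD e₁ e₂) ^ 5 := by rw [hDD]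
      _ = 0 := by linear_combination (s ^ 60) * hKe + (s ^ 60 * kC6 e₁ e₂) * he6
  exact pow_eq_zero_iff (by norm_num) |>.mp hsq

end KleinField

end Summit.ABC.ABC.Cruxes.FreyModularity.StubSwitchK3g9
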